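import Literature.NumberTheory.Automorphic.Liu2021.LemD1AsPrinted
import Mathlib.RepresentationTheory.Intertwining
import HarnessLib

/-!
# [Liu2021, App. D, Lemma D.1 (1) and (3)] EXACTLY AS PRINTED, read on an INDEXED collection of Step 1–3 choices
# (the sub-family form of `LemD1AsPrinted.lean` §2; junk-free carriers for the global consumers)

[Liu2021] = Y. Liu, *Fourier–Jacobi cycles and arithmetic relative trace formula*, Camb. J. Math. **9** (2021) 1–147 =
arXiv:2102.11518; `l. NNNN` = lines of the author's TeX source `FJcycle.tex` (md5 `6db49a74122d2cb0f224fa1b39488a0c`), as in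
`Liu2021/LemD1AsPrinted.lean` (whose §1 `LemD1Data` ∕ `LemD1_1AsPrinted` and §2 `LemD1Family` ∕ `LemD1_3AsPrinted` this
file REUSES; nothing is re-declared).

## What this file is, and why

`LemD1AsPrinted.lean` §2 types items (2)–(4) of Lemma D.1 — in particular **(3)** (l. 5233 = held extraction
`paper:arxiv-2102.11518` p0056 L27): «If `n ≥ 3`, then `ω(μ', ε', χ')` is isomorphic to `ω(μ, ε, χ)` if and only if
`(μ', ε', χ') = (μ, ε, χ)`» — over the family datum `LemD1Family F E n`, whose ⟨CARRIER⟩ is ONE representation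
`ω(μ, ε)` for EVERY Step-2 character `μ ∈ MuSet S` and EVERY Step-1 representative `e ∈ EpsRep S`.  A GLOBAL consumer
([Liu2021, Def. 4.11]: `ω(μ, ε, χ) := ⊗'_v ω(μ_v, ε_v, χ_v)` over adèlic triples; Thm. 4.18 (2) «follows from Lemma D.1»,
l. 2270) meets Lemma D.1 (3) at a place `v` only at the LOCAL COMPONENTS of its own global triples — a sub-collection
`i ↦ (μ_{i,v}, ε_{i,v}, χ_{i,v})` of the printed «all triples», each member carrying the consumer's CONSTRUCTED local Weil
representation (in the tree: `𝓢.omegaLoc v` of the local splittings attached to `μ_i` at the line of `ε_i`, read on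
`U(V)(F_v)`; `Liu2021/Def411WeilCarriersLocalDataAtV.lean`).  To cite (3) LITERALLY at such a collection without positing
carriers at triples the consumer never constructs (which would make the cited sentence speak about junk), this file
types the printed sentences (first sentence + (1), and (3)) over an **indexed family**

* `LemD1IndexedFamily F E n ι` — the local-field layer and the tree's standing data `S` EXACTLY as in `LemD1Family`,
  and for each index `i : ι` a Step-2 character `mu i ∈ MuSet S`, a Step-1 representative `eps i ∈ EpsRep S`, a Step-3
  character `chi i ∈ ChiSet S` (the REAL printed index sets of §2, reused) and the ⟨CARRIER⟩ `omega i = ω(μ_i, ε_i)`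
  (object-match duty (b)/(om1) of N-f1, unchanged: `ω(ε_i) ∘ ι_{μ_i}`);
* `LemD1IndexedFamily.single i : LemD1Data F E n (V i)` — the §1 datum of member `i` (so `Item1AsPrinted` is the §1
  record `LemD1_1AsPrinted` member by member, exactly as `LemD1Family.Item1AsPrinted`);
* **`LemD1_3AsPrintedI Lf`** — item (3) VERBATIM for every pair of members `i, j`: for `3 ≤ n`,
  `ω(μ_j, ε_j, χ_j) ≅ ω(μ_i, ε_i, χ_i)` (READING L7, `AreIsomorphicRep`) iff `μ_j = μ_i`, `ε_j = ε_i` in `E^{−×}/Nm E^×`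
  (`SameClass`, READING L3′) and `χ_j = χ_i`.

READING I3 (the only new interpretive choice): the printed (3) quantifies over ANY two choices of Step 1–3 data; reading it
on the members of an indexed collection is the RESTRICTION of that universal statement along the index map — WEAKER OR
EQUAL to print, and literally §2's reading when the index map is onto all triples: `LemD1Family.toIndexed` turns the
all-triples family into the indexed family over `MuSet S × EpsRep S × ChiSet S`, and `LemD1_3AsPrinted Lf ↔
LemD1_3AsPrintedI Lf.toIndexed` (`lemD1_3AsPrinted_iff_toIndexed`, both directions `Iff.rfl` on the summands); re-indexing
along any map `f : κ → ι` preserves the predicate (`LemD1_3AsPrintedI.comap`).  As for every record of this directory: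
`LemD1_3AsPrintedI Lf` is a PREDICATE on the consumer's OWN indexed data; NOTHING IS ASSERTED here; `∀ Lf,
LemD1_3AsPrintedI Lf` is not Liu's lemma and no declaration of this file has that type; NO PROOF of the lemma (Track 2).
The consumer-shaped consequences (`mu_eq_of_areIsomorphicRep`, `mu_eq_of_equiv`, …) are bookkeeping and proved.

Cell pub-hodgecm2 (COR-CM), Δ2 BRIDGE cite leg `hμsep` (the cross-`μ` separation of the END's `hsep`); seat
prover-pub-hodgecm2-b10-g69-0.  HC_CM is NOT proved; «Δ2 BRIDGE CLOSED» is NOT claimed.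

## References

* [Liu2021] Y. Liu, Camb. J. Math. 9 (2021) = arXiv:2102.11518 — App. D §D.1 Steps 1–3 (l. 5213–5224), Lemma D.1
  (`le:weil_nonarch`, l. 5226–5237), esp. (1) (l. 5229) and (3) (l. 5233); Def. 4.11 (l. 2083–2097); Thm. 4.18 (2) and
  its proof (l. 2241, 2270).
-/

noncomputable section

open Literature.RepresentationTheory.Liu2021 (OscillatorStandingData)
open Literature.RepresentationTheory.CentralCharacterQuotient (augmentation)

namespace Literature.NumberTheory.Automorphic.Liu2021

/-! ## The data of §D.1 over an indexed collection of triples -/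

/-- **The data of [Liu2021, App. D §D.1 + Lemma D.1] over an INDEXED collection of Step 1–3 choices** `i : ι`: the
local-field layer («`F` nonarchimedean», Mathlib; `E` with its module topology) and the tree's standing data `S`
(characteristic `≠ 2`, `E/F` étale of rank `2`, `c`, the hermitian space of rank `n ≥ 2`) exactly as in `LemD1Family`; for
each member `i` a Step-2 character `mu i ∈ MuSet S`, a Step-1 representative `eps i ∈ EpsRep S`, a Step-3 character
`chi i ∈ ChiSet S`, and the ⟨CARRIER⟩ `omega i = ω(μ_i, ε_i) := ω(ε_i) ∘ ι_{μ_i}` on `V i` (posited; object-match duty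
(b)/(om1) of N-f1).  Nothing is asserted by this structure.
[cite: Liu2021, App. D §D.1 (l. 5213–5224) and Lemma D.1 (l. 5226–5237)] -/
structure LemD1IndexedFamily (F E : Type) [Field F] [ValuativeRel F] [TopologicalSpace F] [CommRing E] [Algebra F E]
    [TopologicalSpace E] [IsTopologicalRing E] (n : ℕ) (ι : Type) : Type 1 where
  /-- «`F` … a local field … nonarchimedean» (l. 5213, 5227), Mathlib (READING L1). -/
  isNonarchimedeanLocalField : IsNonarchimedeanLocalField F
  /-- the topology of `E` is its module topology over `F`. -/
  isModuleTopology : IsModuleTopology F E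
  /-- the standing data of §D.1 (tree `OscillatorStandingData`). -/
  S : OscillatorStandingData F E n
  /-- Step 2 (l. 5219) for member `i`: its character `μ_i`, an element of the printed set `MuSet S`. -/
  mu : ι → LemD1.MuSet S
  /-- Step 1 (l. 5217) for member `i`: its representative `ε_i ∈ E^{−×}`, an element of `EpsRep S`. -/
  eps : ι → LemD1.EpsRep S
  /-- Step 3 (l. 5221) for member `i`: its character `χ_i : E^1 → ℂ^1`, an element of `ChiSet S`. -/
  chi : ι → LemD1.ChiSet S
  /-- ⟨CARRIER⟩ the space of `ω(μ_i, ε_i)` … -/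
  V : ι → Type
  [instAddCommGroupV : ∀ i, AddCommGroup (V i)]
  [instModuleV : ∀ i, Module ℂ (V i)]
  /-- ⟨CARRIER⟩ … with its `U(V)(F)`-action: «`ω(μ, ε) := ω(ε) ∘ ι_μ`» at `(μ_i, ε_i)` (Steps 1–2); N-f1 duty (b)/(om1). -/
  omega : ∀ i, Representation ℂ S.U (V i)

attribute [instance] LemD1IndexedFamily.instAddCommGroupV LemD1IndexedFamily.instModuleV

namespace LemD1IndexedFamily

variable {F E : Type} [Field F] [ValuativeRel F] [TopologicalSpace F] [CommRing E] [Algebra F E]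
  [TopologicalSpace E] [IsTopologicalRing E] {n : ℕ} {ι : Type} (Lf : LemD1IndexedFamily F E n ι)

/-- The single-triple datum of §1 of member `i`: same local field, same standing data, `ε := eps i`, `μ := mu i`,
`χ := chi i`, `ω(μ, ε) := omega i`. [cite: Liu2021, App. D §D.1 Steps 1–3 (l. 5217–5221)] -/
def single (i : ι) : LemD1Data F E n (Lf.V i) where
  isNonarchimedeanLocalField := Lf.isNonarchimedeanLocalField
  isModuleTopology := Lf.isModuleTopology
  S := Lf.S
  eps := (Lf.eps i).1
  eps_mem_skew := (Lf.eps i).2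
  mu := (Lf.mu i).1
  norm_mu := (Lf.mu i).2.1
  continuous_mu := (Lf.mu i).2.2.1
  mu_algebraMap_eq_one_iff := (Lf.mu i).2.2.2
  chi := (Lf.chi i).1
  norm_chi := (Lf.chi i).2.1
  continuous_chi := (Lf.chi i).2.2
  omega := Lf.omega i

/-- unfolding: the standing data of `single i` is `Lf.S`. [cite: Liu2021, App. D §D.1 (l. 5213)] -/
@[simp] theorem single_S (i : ι) : (Lf.single i).S = Lf.S := rfl

/-- unfolding: the `μ` of `single i` is `(mu i).1`. [cite: Liu2021, App. D §D.1 Step 2 (l. 5219)] -/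
@[simp] theorem single_mu (i : ι) : (Lf.single i).mu = (Lf.mu i).1 := rfl

/-- unfolding: the representative of `single i` is `(eps i).1`. [cite: Liu2021, App. D §D.1 Step 1 (l. 5217)] -/
@[simp] theorem single_eps (i : ι) : (Lf.single i).eps = (Lf.eps i).1 := rfl

/-- unfolding: the character of `single i` is `(chi i).1`. [cite: Liu2021, App. D §D.1 Step 3 (l. 5221)] -/
@[simp] theorem single_chi (i : ι) : (Lf.single i).chi = (Lf.chi i).1 := rfl

/-- unfolding: the carrier of `single i` is `omega i`. [cite: Liu2021, App. D §D.1 Steps 1–2 (l. 5217–5219)] -/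
@[simp] theorem single_omega (i : ι) : (Lf.single i).omega = Lf.omega i := rfl

/-- `ω(μ_i, ε_i, χ_i)` of member `i`: the representation of `U(V)(F)` on the maximal `χ_i`-quotient of `ω(μ_i, ε_i)`
(constructed, `= (Lf.single i).datum.quot = quotRep …`). [cite: Liu2021, App. D §D.1 Step 3 (l. 5221)] -/
abbrev quot (i : ι) : Representation ℂ Lf.S.U (Lf.V i ⧸ augmentation (Lf.omega i) Lf.S.scalar (Lf.chi i).1) :=
  (Lf.single i).datum.quot

/-- **Re-indexing** along `f : κ → ι`: the sub-collection `k ↦ member (f k)` (same standing data, same carriers).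
[cite: Liu2021, App. D §D.1 Steps 1–3 (l. 5217–5221)] -/
def comap {κ : Type} (f : κ → ι) : LemD1IndexedFamily F E n κ where
  isNonarchimedeanLocalField := Lf.isNonarchimedeanLocalField
  isModuleTopology := Lf.isModuleTopology
  S := Lf.S
  mu := fun k => Lf.mu (f k)
  eps := fun k => Lf.eps (f k)
  chi := fun k => Lf.chi (f k)
  V := fun k => Lf.V (f k)
  omega := fun k => Lf.omega (f k)

/-- unfolding: the members of `comap f` are the members `f k`. [cite: Liu2021, App. D §D.1 Steps 1–3 (l. 5217–5221)] -/
theorem single_comap {κ : Type} (f : κ → ι) (k : κ) : (Lf.comap f).single k = Lf.single (f k) := rfl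

end LemD1IndexedFamily

/-! ## Lemma D.1, first sentence + (1), and item (3), exactly as printed, over the indexed collection -/

/-- **[Liu2021, App. D, Lemma D.1, first sentence and item (1)] for every member of the collection**: at each `i` the
single-datum record `LemD1_1AsPrinted (Lf.single i)` of `LemD1AsPrinted.lean` §1 («Suppose that `F` is nonarchimedean.
Then `ω(μ, ε, χ)` is irreducible and admissible. Moreover, (1) `ω(μ, ε, χ)` is zero if and only if `E` is a field, `V` is
anisotropic (in particular `n = 2`), and `χ̌ = μ²`.», l. 5227–5229).  A predicate on `Lf`; not asserted; NO PROOF.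
[cite: Liu2021, App. D Lemma D.1 (1) (l. 5226–5229)] -/
def LemD1IndexedFamily.Item1AsPrinted {F E : Type} [Field F] [ValuativeRel F] [TopologicalSpace F] [CommRing E]
    [Algebra F E] [TopologicalSpace E] [IsTopologicalRing E] {n : ℕ} {ι : Type} (Lf : LemD1IndexedFamily F E n ι) : Prop :=
  ∀ i, LemD1_1AsPrinted (Lf.single i)

/-- **[Liu2021, App. D, Lemma D.1 (3)] EXACTLY AS PRINTED** (l. 5233 = p0056 L27): «If `n ≥ 3`, then `ω(μ', ε', χ')` is
isomorphic to `ω(μ, ε, χ)` if and only if `(μ', ε', χ') = (μ, ε, χ)`.»  TYPED, on the indexed collection (READING I3: the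
printed universal statement over two choices of Step 1–3 data, restricted along the index map): for `3 ≤ n` and all members
`i, j`, `ω(μ_j, ε_j, χ_j) ≅ ω(μ_i, ε_i, χ_i)` (READING L7, `AreIsomorphicRep`) iff `μ_j = μ_i`, `ε_j = ε_i` in
`E^{−×}/Nm E^×` (`SameClass` of the representatives, READING L3′) and `χ_j = χ_i`.  At the all-triples indexing this IS
`LemD1_3AsPrinted` (`lemD1_3AsPrinted_iff_toIndexed`).  A predicate on `Lf`; not asserted; NO PROOF.
[cite: Liu2021, App. D Lemma D.1 (3) (l. 5233)] -/
def LemD1_3AsPrintedI {F E : Type} [Field F] [ValuativeRel F] [TopologicalSpace F] [CommRing E] [Algebra F E]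
    [TopologicalSpace E] [IsTopologicalRing E] {n : ℕ} {ι : Type} (Lf : LemD1IndexedFamily F E n ι) : Prop :=
  3 ≤ n → ∀ i j : ι,
    AreIsomorphicRep (Lf.quot j) (Lf.quot i) ↔ (Lf.mu j = Lf.mu i ∧ LemD1.SameClass (Lf.eps i) (Lf.eps j) ∧ Lf.chi j = Lf.chi i)

/-! ## §2's all-triples family as an indexed collection: the two readings coincide -/

namespace LemD1Family

variable {F E : Type} [Field F] [ValuativeRel F] [TopologicalSpace F] [CommRing E] [Algebra F E]
  [TopologicalSpace E] [IsTopologicalRing E] {n : ℕ} (Lf : LemD1Family F E n)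

/-- The all-triples family of `LemD1AsPrinted.lean` §2 as an indexed collection over the printed index set
`MuSet S × EpsRep S × ChiSet S` (every triple a member; carrier `ω(μ, ε)` at `(μ, ε, χ)`).
[cite: Liu2021, App. D §D.1 Steps 1–3 (l. 5217–5221)] -/
def toIndexed : LemD1IndexedFamily F E n (LemD1.MuSet Lf.S × LemD1.EpsRep Lf.S × LemD1.ChiSet Lf.S) where
  isNonarchimedeanLocalField := Lf.isNonarchimedeanLocalField
  isModuleTopology := Lf.isModuleTopology
  S := Lf.S
  mu := fun t => t.1
  eps := fun t => t.2.1
  chi := fun t => t.2.2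
  V := fun t => Lf.V t.1 t.2.1
  omega := fun t => Lf.omega t.1 t.2.1

/-- unfolding: the member `(μ, e, χ)` of `toIndexed` is the §2 single datum `Lf.single μ e χ`.
[cite: Liu2021, App. D §D.1 Steps 1–3 (l. 5217–5221)] -/
theorem single_toIndexed (μ : LemD1.MuSet Lf.S) (e : LemD1.EpsRep Lf.S) (χ : LemD1.ChiSet Lf.S) :
    Lf.toIndexed.single (μ, e, χ) = Lf.single μ e χ := rfl

/-- Lemma D.1, first sentence + (1): the §2 family form IS the indexed form at `toIndexed`.
[cite: Liu2021, App. D Lemma D.1 (1) (l. 5226–5229)] -/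
theorem item1AsPrinted_iff_toIndexed : Lf.Item1AsPrinted ↔ Lf.toIndexed.Item1AsPrinted :=
  ⟨fun h t => h t.1 t.2.1 t.2.2, fun h μ e χ => h (μ, e, χ)⟩

/-- **READING I3 is §2's reading at the all-triples indexing**: `LemD1_3AsPrinted Lf ↔ LemD1_3AsPrintedI Lf.toIndexed`
(the summands agree on the nose; only the bookkeeping of the pair `(ε, ε')` ∕ `(μ, μ')` is rearranged).
[cite: Liu2021, App. D Lemma D.1 (3) (l. 5233)] -/
theorem lemD1_3AsPrinted_iff_toIndexed : LemD1_3AsPrinted Lf ↔ LemD1_3AsPrintedI Lf.toIndexed :=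
  ⟨fun h hn i j => h hn i.1 j.1 i.2.1 j.2.1 i.2.2 j.2.2, fun h hn μ μ' e e' χ χ' => h hn (μ, e, χ) (μ', e', χ')⟩

end LemD1Family

/-! ## Consequences in the shapes the consumers use (bookkeeping; every declaration below is proved) -/

namespace LemD1_3AsPrintedI

variable {F E : Type} [Field F] [ValuativeRel F] [TopologicalSpace F] [CommRing E] [Algebra F E]
  [TopologicalSpace E] [IsTopologicalRing E] {n : ℕ} {ι : Type} {Lf : LemD1IndexedFamily F E n ι}

/-- **Re-indexing**: item (3) read on a collection holds on every sub-collection `comap f` (READING I3 is monotone in the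
index map). [cite: Liu2021, App. D Lemma D.1 (3) (l. 5233)] -/
theorem comap (h3 : LemD1_3AsPrintedI Lf) {κ : Type} (f : κ → ι) : LemD1_3AsPrintedI (Lf.comap f) :=
  fun hn k l => h3 hn (f k) (f l)

/-- Item (3) in use: for `n ≥ 3`, isomorphic members have the same Step-2 character `μ` (the local print anchor of
[Liu2021] Thm. 4.18 (2), «Statement (2) follows from Lemma D.1», l. 2270). [cite: Liu2021, App. D Lemma D.1 (3) (l. 5233)] -/
theorem mu_eq_of_areIsomorphicRep (h3 : LemD1_3AsPrintedI Lf) (hn : 3 ≤ n) {i j : ι}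
    (hiso : AreIsomorphicRep (Lf.quot j) (Lf.quot i)) : Lf.mu j = Lf.mu i :=
  ((h3 hn i j).1 hiso).1

/-- … as an equality of the underlying homomorphisms `E^× → ℂ^×`. [cite: Liu2021, App. D Lemma D.1 (3) (l. 5233)] -/
theorem mu_val_eq_of_areIsomorphicRep (h3 : LemD1_3AsPrintedI Lf) (hn : 3 ≤ n) {i j : ι}
    (hiso : AreIsomorphicRep (Lf.quot j) (Lf.quot i)) : (Lf.mu j).1 = (Lf.mu i).1 :=
  congrArg Subtype.val (h3.mu_eq_of_areIsomorphicRep hn hiso)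

/-- … and the same `χ` and the same class of `ε`. [cite: Liu2021, App. D Lemma D.1 (3) (l. 5233)] -/
theorem sameClass_and_chi_eq_of_areIsomorphicRep (h3 : LemD1_3AsPrintedI Lf) (hn : 3 ≤ n) {i j : ι}
    (hiso : AreIsomorphicRep (Lf.quot j) (Lf.quot i)) : LemD1.SameClass (Lf.eps i) (Lf.eps j) ∧ Lf.chi j = Lf.chi i :=
  ((h3 hn i j).1 hiso).2

/-- Item (3), converse direction as printed («if and only if»): equal parameters — the representatives of `ε` in the same
class — give isomorphic `ω`'s. [cite: Liu2021, App. D Lemma D.1 (3) (l. 5233)] -/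
theorem areIsomorphicRep_of_eq (h3 : LemD1_3AsPrintedI Lf) (hn : 3 ≤ n) {i j : ι} (hμ : Lf.mu j = Lf.mu i)
    (he : LemD1.SameClass (Lf.eps i) (Lf.eps j)) (hχ : Lf.chi j = Lf.chi i) : AreIsomorphicRep (Lf.quot j) (Lf.quot i) :=
  (h3 hn i j).2 ⟨hμ, he, hχ⟩

/-- Item (3) read on a Mathlib `Representation.Equiv` (READING L7 = an intertwining linear equivalence): for `n ≥ 3`, an
equivalence `ω(μ_j, ε_j, χ_j) ≃ ω(μ_i, ε_i, χ_i)` forces `μ_j = μ_i`. [cite: Liu2021, App. D Lemma D.1 (3) (l. 5233)] -/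
theorem mu_eq_of_equiv (h3 : LemD1_3AsPrintedI Lf) (hn : 3 ≤ n) {i j : ι} (f : (Lf.quot j).Equiv (Lf.quot i)) :
    Lf.mu j = Lf.mu i :=
  h3.mu_eq_of_areIsomorphicRep hn
    ⟨f.toLinearEquiv, fun g v => by
      rw [Representation.Equiv.toLinearEquiv_apply, Representation.Equiv.toLinearEquiv_apply]
      exact f.toIntertwiningMap.isIntertwining _ _ g v⟩

/-- … symmetric form: an equivalence `ω_i ≃ ω_j` (either direction) forces `μ_i = μ_j`. [cite: Liu2021, App. D Lemma D.1 (3) (l. 5233)] -/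
theorem mu_eq_of_nonempty_equiv (h3 : LemD1_3AsPrintedI Lf) (hn : 3 ≤ n) {i j : ι} (h : Nonempty ((Lf.quot i).Equiv (Lf.quot j))) :
    Lf.mu i = Lf.mu j := by
  obtain ⟨f⟩ := h
  exact h3.mu_eq_of_equiv hn f

end LemD1_3AsPrintedI

namespace LemD1IndexedFamily

variable {F E : Type} [Field F] [ValuativeRel F] [TopologicalSpace F] [CommRing E] [Algebra F E]
  [TopologicalSpace E] [IsTopologicalRing E] {n : ℕ} {ι : Type} {Lf : LemD1IndexedFamily F E n ι}

/-- From the member-wise form of item (1): for `n ≥ 3` every `ω(μ_i, ε_i, χ_i)` of the collection is a non-zero space.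
[cite: Liu2021, App. D Lemma D.1 (1) (l. 5229)] -/
theorem Item1AsPrinted.nontrivial_of_three_le (h : Lf.Item1AsPrinted) (hn : 3 ≤ n) (i : ι) :
    Nontrivial (Lf.V i ⧸ augmentation (Lf.omega i) Lf.S.scalar (Lf.chi i).1) :=
  (h i).nontrivial_of_three_le hn

/-- Re-indexing preserves the member-wise item (1). [cite: Liu2021, App. D Lemma D.1 (1) (l. 5226–5229)] -/
theorem Item1AsPrinted.comap (h : Lf.Item1AsPrinted) {κ : Type} (f : κ → ι) : (Lf.comap f).Item1AsPrinted :=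
  fun k => h (f k)

end LemD1IndexedFamily

end Literature.NumberTheory.Automorphic.Liu2021

end
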